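import Summits.ABC.IUTFork.Joshi.HodgeTheatersJoshiWitness
import HarnessLib

/-!
# Joshi, *Arithmetic Teichmüller spaces III*, Rmk. 10.11.5.2 (2)–(5): the typeable kernel of the remarks on
# Thm. 10.11.5.1 — TYPED as claims, with what follows in kernel from the §10.11 signature (isomorphism-invariants of
# Hodge theaters take one value on all holomorphoids) and an honest-valued two-holomorphoid witness

Defs-light companion of `Joshi/HodgeTheatersJoshi.lean` (p433245) and `Joshi/HodgeTheatersJoshiWitness.lean` (p433792) — abc-iut cell,
branch E «type Joshi's construction, test vs S» (rung LADDER-ABC:A2.E), seat abc-iut-E-t32 (gen 2), registry rows J3:Rmk10.11.5.2 and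
(2)–(5) (E-dag JOSHI-DAG v1.4.1; E-plan-2 booking rule 09:19:12Z «map lines first; prose-only clauses → WAIVE; type only the genuinely
missing rows in ONE companion»). Source: K. Joshi, arXiv:2401.13508 **v4**, p.141 l.26–44 (render `HOME/lit/renders/Joshi-arxiv-2401.13508/
p0141.txt`); bib `Joshi2024ATS3`. UNREFEREED preprint; everything is TYPED AS A CANDIDATE (D-0012): typed ≠ proved ≠ endorsed; Joshi's
sentences are `def … : Prop` with `@[claim "Joshi2024ATS3" "disputed"]`, never asserted; what FOLLOWS from the typed signature is a
`theorem`. No side taken on [IUTchIII] Cor. 3.12, on [Scholze 2021], or on any author.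

WHAT IS TYPED. Of the five clauses only two contain a mathematical sentence about the objects of §10.11:
* (5), first half (p.141 l.41–44): «That distinct arithmetic holomorphic structures exist … is asserted in [Mochizuki, 2021a,b,c] and
  unequivocally established in the present series of papers» — with the proof of Thm. 10.11.5.1 (p.141 l.4–5: «there are many
  inequivalent geometric data indexed by `y ∈ 𝒴′_{L′}`») READ over the signature `HodgeTheaterDatum` as: two holomorphoids with DISTINCT
  arithmeticoids `y ∈ 𝒴_{L′}` (`DistinctHolomorphoidsExist`). Flag for E-ref: finer inequivalence notions (isometry classes of untilts,
  [ATS I] §3, seat E-t1's `UntiltRescaled`/`ActionDilates`) refine `≠` on the index; the index is what the print uses here.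
* (3) (p.141 l.33–36): «The central point which is missing in [Mochizuki, 2021a,b,c] (and in [Scholze, 2021]) is the existence of
  geometrically inequivalent data providing the above Hodge-Theaters» = two holomorphoids with distinct arithmeticoids whose Hodge theaters
  (10.11.4.1) are isomorphic (`InequivalentDataIsoTheaters`).
(5), second half («that such an averaging is possible») is [J-III] Thm. 9.11.1 / Cor. 9.11.1.1 / Thm.-Def. 9.8.1.1, in the tree as
`ATS3.FundamentalEstimateSetting.Thm9111`, `.Cor91111` (seat E-t22 et al., `Joshi/ATS3FundamentalEstimateStatement.lean`) — cited BY
NAME, not restated. (1) is in p433245 (`HodgeTheater` docstring); (2) «Hodge Theaters of [Mochizuki] consist of data coarser than the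
geometric data …» and (4) «Readers of [Scholze, 2021] may have drawn the (erroneous) conclusion …» are sentences about other TEXTS with no
carrier among the objects — verbatim in p433245's docstring of `HodgeTheatersIsomorphic`, WAIVED as prose on STATUS; their one
mathematical shadow («coarser» = the theater is a function of the geometric datum which, under Thm. 10.11.5.1, is CONSTANT up to
isomorphism) is `theater_constant_upToIso`.

WHAT IS DERIVED (kernel; bookkeeping consequences of the typing, `[folklore]`): (a) (3) ⟺ (5a) given Thm. 10.11.5.1
(`inequivalentDataIsoTheaters_iff`); (b) the LOCATED form of (3)/(4)/(5): under Thm. 10.11.5.1 every isomorphism-invariant of Hodge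
theaters takes one and the same value on all `HT(hol(X/L′)_y)` (`IsIsoInvariant.eq_of_hodgeTheatersIsomorphic`); hence, as soon as two
holomorphoids have distinct arithmeticoids, NO isomorphism-invariant of the theater recovers the label `y` of Rmk. 10.11.4.3
(`label_not_isoInvariant`), and any quantity that DOES separate two holomorphoids is not an isomorphism-invariant of their theaters
(`not_isoInvariant_of_separates`) — i.e. whatever distinguishes «distinct arithmetic holomorphic structures» is carried by the geometric
data (`y`, the local holomorphoids), not by the Hodge theater up to isomorphism: the division of labour (3)/(5) state and the
equivalence (4) starts from, as ONE kernel sentence, no adjudication. (c) NON-VACUITY: an honest-valued two-holomorphoid datum (two points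
over one place, values `ℚ ↪ (ℚ_2, |−|_2)` as in p433792, the global Frobenioids of both points the SAME value construction = TOY form of
Thm. 10.11.3.1 (3)) in which Thm. 10.11.5.1, (3) and (5a) hold together (`twoHol_hodgeTheatersIsomorphic`, `twoHol_distinct`,
`twoHol_inequivalentDataIsoTheaters`) — jointly satisfiable over the signature — and (b) bites (`twoHol_label_not_isoInvariant`).
Labelled TOY: no model of Joshi's curves, `𝒴_{L′}`, tempered Frobenioids. [claim: Joshi2024ATS3, status: disputed]
-/

noncomputable section

namespace Summit.ABC.IUTFork.Joshi.ATS3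

namespace HodgeTheaterDatum

variable {M : ModuliDescentDatum} {FT : Type 1} (𝔇 : HodgeTheaterDatum M FT)

/-! ## 1. Rmk. 10.11.5.2 (5a) and (3) as claim-`Prop`s over the §10.11 signature -/

/-- **Rmk. 10.11.5.2 (5), first half** (p.141 l.41–44): «That distinct arithmetic holomorphic structures exist [and that such an averaging is
possible] is asserted in [Mochizuki, 2021a,b,c] and unequivocally established in the present series of papers ([Joshi, 2021a, 2022, 2023b,a]
and this paper).» READ over the signature with the proof of Thm. 10.11.5.1 (p.141 l.4–5 «there are many inequivalent geometric data indexed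
by `y ∈ 𝒴′_{L′}`»): there are two holomorphoids `hol(X/L′)_{y₁}`, `hol(X/L′)_{y₂}` with distinct arithmeticoids `y₁ ≠ y₂`. HYPOTHESIS, never
asserted (the averaging half is `ATS3.FundamentalEstimateSetting.Thm9111` / `.Cor91111`, BY NAME). [claim: Joshi2024ATS3, status: disputed] -/
@[claim "Joshi2024ATS3" "disputed"]
def DistinctHolomorphoidsExist : Prop := ∃ h₁ h₂ : 𝔇.Hol, 𝔇.pt h₁ ≠ 𝔇.pt h₂

/-- **Rmk. 10.11.5.2 (3)** (p.141 l.33–36): «The above proposition should be contrasted with [Scholze, 2021]. The central point which is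
missing in [Mochizuki, 2021a,b,c] (and in [Scholze, 2021]) is the existence of geometrically inequivalent data providing the above
Hodge-Theaters.» READ: two holomorphoids with distinct arithmeticoids whose Hodge theaters `HT(hol(X/L′)_y)` (10.11.4.1, `hodgeTheaterOf`)
are isomorphic (`HodgeTheater.Iso`). HYPOTHESIS, never asserted. [claim: Joshi2024ATS3, status: disputed] -/
@[claim "Joshi2024ATS3" "disputed"]
def InequivalentDataIsoTheaters : Prop :=
  ∃ h₁ h₂ : 𝔇.Hol, 𝔇.pt h₁ ≠ 𝔇.pt h₂ ∧ Nonempty ((𝔇.hodgeTheaterOf h₁).Iso (𝔇.hodgeTheaterOf h₂))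

variable {𝔇}

/-- (3) follows from Thm. 10.11.5.1 (`HodgeTheatersIsomorphic`) and (5a): the isomorphism is supplied by the theorem. [folklore] -/
theorem inequivalentDataIsoTheaters_of_hodgeTheatersIsomorphic (hT : 𝔇.HodgeTheatersIsomorphic)
    (hD : 𝔇.DistinctHolomorphoidsExist) : 𝔇.InequivalentDataIsoTheaters := by
  obtain ⟨h₁, h₂, hne⟩ := hD
  exact ⟨h₁, h₂, hne, hT h₁ h₂⟩

/-- (3) contains (5a): inequivalent data providing the theaters are in particular distinct holomorphoids. [folklore] -/
theorem InequivalentDataIsoTheaters.distinctHolomorphoidsExist (h : 𝔇.InequivalentDataIsoTheaters) :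
    𝔇.DistinctHolomorphoidsExist := by
  obtain ⟨h₁, h₂, hne, _⟩ := h
  exact ⟨h₁, h₂, hne⟩

/-- Given Thm. 10.11.5.1, Rmk. 10.11.5.2 (3) and (5a) are EQUIVALENT readings. [folklore] -/
theorem inequivalentDataIsoTheaters_iff (hT : 𝔇.HodgeTheatersIsomorphic) :
    𝔇.InequivalentDataIsoTheaters ↔ 𝔇.DistinctHolomorphoidsExist :=
  ⟨fun h => h.distinctHolomorphoidsExist, inequivalentDataIsoTheaters_of_hodgeTheatersIsomorphic hT⟩

/-! ## 2. The located form of (3)/(4)/(5): isomorphism-invariants of Hodge theaters do not see the holomorphoid -/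

variable (𝔇) in
/-- An ISOMORPHISM-INVARIANT of Hodge theaters à la Joshi: a quantity attached to a theater (10.11.4.1) taking equal values on isomorphic
theaters (isomorphisms of all constituents, `HodgeTheater.Iso`; [IUTchI] Rmk. 3.6.2 reading). [folklore] -/
def IsIsoInvariant {α : Sort*} (F : 𝔇.HodgeTheater → α) : Prop :=
  ∀ H₁ H₂ : 𝔇.HodgeTheater, Nonempty (H₁.Iso H₂) → F H₁ = F H₂

/-- **Under Thm. 10.11.5.1 every isomorphism-invariant of Hodge theaters takes ONE value on all holomorphoids** `hol(X/L′)_y` — the kernel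
sentence behind Rmk. 10.11.5.2 (3)–(5) («[Cor. 3.12] is not about Hodge-Theaters … per se») and behind the equivalence (4) refers to;
bookkeeping of the typing, no adjudication. [folklore] -/
theorem IsIsoInvariant.eq_of_hodgeTheatersIsomorphic {α : Sort*} {F : 𝔇.HodgeTheater → α} (hF : 𝔇.IsIsoInvariant F)
    (hT : 𝔇.HodgeTheatersIsomorphic) (h₁ h₂ : 𝔇.Hol) : F (𝔇.hodgeTheaterOf h₁) = F (𝔇.hodgeTheaterOf h₂) :=
  hF _ _ (hT h₁ h₂)

/-- Contrapositive: a quantity of the theater that SEPARATES two holomorphoids is not an isomorphism-invariant (given Thm. 10.11.5.1) —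
whatever distinguishes «distinct arithmetic holomorphic structures» (Rmk. 10.11.5.2 (5)) is not carried by the theater up to
isomorphism. [folklore] -/
theorem not_isoInvariant_of_separates (hT : 𝔇.HodgeTheatersIsomorphic) {α : Sort*} {F : 𝔇.HodgeTheater → α} {h₁ h₂ : 𝔇.Hol}
    (hsep : F (𝔇.hodgeTheaterOf h₁) ≠ F (𝔇.hodgeTheaterOf h₂)) : ¬ 𝔇.IsIsoInvariant F :=
  fun hF => hsep (hF.eq_of_hodgeTheatersIsomorphic hT h₁ h₂)

/-- **The label `y` of a Hodge theater (Rmk. 10.11.4.3) is not an isomorphism-invariant of the theater** as soon as Thm. 10.11.5.1 and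
Rmk. 10.11.5.2 (5a) hold: no isomorphism-invariant `F : HT ↦ 𝒴_{L′}` returns the arithmeticoid of every `HT(hol(X/L′)_y)`. The located
content of (3): the «geometrically inequivalent data» live beside the theater, not inside it up to isomorphism. [folklore] -/
theorem label_not_isoInvariant (hT : 𝔇.HodgeTheatersIsomorphic) (hD : 𝔇.DistinctHolomorphoidsExist) {F : 𝔇.HodgeTheater → M.Arith}
    (hF : 𝔇.IsIsoInvariant F) : ¬ ∀ h : 𝔇.Hol, F (𝔇.hodgeTheaterOf h) = 𝔇.pt h := by
  intro hlab
  obtain ⟨h₁, h₂, hne⟩ := hD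
  exact hne (by rw [← hlab h₁, ← hlab h₂]; exact hF.eq_of_hodgeTheatersIsomorphic hT h₁ h₂)

/-- The mathematical shadow of Rmk. 10.11.5.2 (2) «Hodge Theaters … consist of data coarser than the geometric data»: the theater is a
function `hodgeTheaterOf` of the geometric datum which, under Thm. 10.11.5.1 and given one holomorphoid `h₀`, is CONSTANT up to isomorphism
(every theater is isomorphic to `HT(hol(X/L′)_{y₀})`). [folklore] -/
theorem theater_constant_upToIso (hT : 𝔇.HodgeTheatersIsomorphic) (h₀ : 𝔇.Hol) :
    ∃ H₀ : 𝔇.HodgeTheater, ∀ h : 𝔇.Hol, Nonempty ((𝔇.hodgeTheaterOf h).Iso H₀) :=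
  ⟨𝔇.hodgeTheaterOf h₀, fun h => hT h h₀⟩

end HodgeTheaterDatum

/-! ## 3. Non-vacuity: an honest-valued two-holomorphoid datum in which Thm. 10.11.5.1, (3) and (5a) hold together -/

/-- TOY descent datum with TWO points over its single place (`|𝒴| = Bool` upstairs and downstairs, identity projection) — so that two
holomorphoids can carry distinct arithmeticoids. NOT a model of §3.1/§3.3. [folklore] -/
def twoPointDescent : ModuliDescentDatum where
  VL' := Unit
  Vmod := Unit
  LiesOver _ _ := True
  sel := id
  sel_liesOver _ := trivial
  sel_injective := Function.injective_id
  Y _ := Bool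
  Ymod _ := Bool
  proj _ _ _ y := y

/-- HONEST values over the two points: both residue fields `ℚ_2` with `|−|_2` and `ℚ ↪ ℚ_2` (as in p433792's `witnessAbsDatum`); the two points
are told apart by their index only — their residue-field values agree, which is what makes their arithmetic Frobenioids coincide below (TOY form
of Thm. 10.11.3.1 (3): all `Frob(arith(L_mod)_y)` isomorphic to one Frobenioid). [folklore] -/
def twoPointAbsDatum : ArithmeticoidAbsDatum ℚ Unit (fun _ => Bool) (fun _ _ => ℚ_[2]) where
  abs _ _ := Frob.normAbs ℚ_[2]
  emb _ _ := Rat.castHom ℚ_[2]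

/-- The value-constructed realified Frobenioid `Frob(arith(ℚ)_y)^ℝ` of `twoPointAbsDatum` does not depend on the point `y` (same residue
field and value at both points) — definitionally. [folklore] -/
theorem twoPoint_frobArithR_eq (y₁ y₂ : Unit → Bool) : twoPointAbsDatum.frobArithR y₁ = twoPointAbsDatum.frobArithR y₂ := rfl

/-- TOY two-holomorphoid Hodge-theater datum over `twoPointDescent`: holomorphoids `Bool` labelled by the two points, trivial local
tempered-Frobenioid data (`FT = PUnit`, all local «isomorphisms» exist — the LOCAL half of Thm. 10.11.5.1 is thereby assumed, as in print
via [André 2003b]), global Frobenioids HONESTLY the value construction on `twoPointAbsDatum`. [folklore] -/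
def twoHolDatum : HodgeTheaterDatum twoPointDescent PUnit.{2} where
  Hol := Bool
  pt b _ := b
  ATS _ := Bool
  localOf b _ := b
  arithOfPoint P := P
  frobTempAt _ _ := PUnit.unit
  IsoFT _ _ := Unit
  frobArith y := twoPointAbsDatum.frobArith y
  frobArithR y := twoPointAbsDatum.frobArithR y
  frobModPf := twoPointAbsDatum.frobArith fun _ => true
  frobModR := twoPointAbsDatum.frobArithR fun _ => true

/-- In the two-holomorphoid datum **Thm. 10.11.5.1 holds**: the theaters of the two (distinct) holomorphoids are isomorphic — locally by the
trivial local data, globally because the two value-constructed realified Frobenioids coincide (`twoPoint_frobArithR_eq`). [folklore] -/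
theorem twoHol_hodgeTheatersIsomorphic : twoHolDatum.HodgeTheatersIsomorphic := fun h₁ h₂ => by
  cases h₁ <;> cases h₂ <;> exact ⟨⟨fun _ => (), ElementaryFrobenioid.Iso.refl _⟩⟩

/-- In the two-holomorphoid datum **Rmk. 10.11.5.2 (5a) holds**: the two holomorphoids have distinct arithmeticoids. [folklore] -/
theorem twoHol_distinct : twoHolDatum.DistinctHolomorphoidsExist :=
  ⟨true, false, fun h => Bool.noConfusion (congrFun h ())⟩

/-- Hence **Rmk. 10.11.5.2 (3) holds** in the two-holomorphoid datum: geometrically inequivalent (distinctly indexed) data providing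
isomorphic Hodge theaters EXIST there — the three claim-`Prop`s are jointly satisfiable over the §10.11 signature. TOY. [folklore] -/
theorem twoHol_inequivalentDataIsoTheaters : twoHolDatum.InequivalentDataIsoTheaters :=
  HodgeTheaterDatum.inequivalentDataIsoTheaters_of_hodgeTheatersIsomorphic twoHol_hodgeTheatersIsomorphic twoHol_distinct

/-- … and §2 bites non-vacuously: in the two-holomorphoid datum NO isomorphism-invariant of Hodge theaters recovers the label. [folklore] -/
theorem twoHol_label_not_isoInvariant {F : twoHolDatum.HodgeTheater → twoPointDescent.Arith} (hF : twoHolDatum.IsIsoInvariant F) :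
    ¬ ∀ h, F (twoHolDatum.hodgeTheaterOf h) = twoHolDatum.pt h :=
  HodgeTheaterDatum.label_not_isoInvariant twoHol_hodgeTheatersIsomorphic twoHol_distinct hF

end Summit.ABC.IUTFork.Joshi.ATS3

end
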